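/-
Copyright (c) 2026 the pub-hodgecm-mathlib formalisation cell (harness21).  Prover seat hodgecm-mathlib-A-p13 (g40), second hand of
LD1-p02 (g4) on the ι-step (P4) of brick (Gα-C∞) `ArchLadder` (line LD1 of crux `HLiu418`; LD1-plan (g2) DEALS #12 (1)), sub-brick (P4c-ii),
2026-09-02.  KERNEL module: THEOREMS ONLY (no definition, no named fact, no `sorry`, no instance, no notation).
-/
import Literature.NumberTheory.GelbartRogawski1991.DoubledWeilRepresentationArchPlaceHermite
import Literature.Analysis.FunctionSpaces.WightmanGNSContinuity
import HarnessLib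

/-!
# β-II ON A GENERAL FIRST SLOT: the doubled metaplectic operator `μ₀((W ⊕ 1)^{e₂} at v₀)` acts on `frameD^* R_{e₂}(a ⊠ h^V_{β₂})` through
# `μ₀(W at v₀)` on the first factor, for EVERY Schwartz function `a` (not only Hermite functions)

Topic `NumberTheory/GelbartRogawski1991`; namespace `Literature.NumberTheory.GelbartRogawski1991.GRConstruction` (that of ★
`DoubledWeilRepresentationArchPlaceHermite` = β-II, whose variables `(L) (e) (dV hdV hdV0) (dW hdW hdW0)` and frames `frameD` ∕ `frameV` this file
continues).  Cell hodgecm-mathlib FLOOR 0, crux `HLiu418` = stmt-HodgeConjecture-24832, line LD1, brick (Gα-C∞) `ArchLadder`, ι-step (P4) of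
LD1-p02 (g4) (bus 2026-09-02T10:25:17Z cut (P4a)–(P4d); sub-brick (P4c-ii) offered 10:44:57Z, taken by A-p13 (g40) 10:45:37Z).

* §1 `archBoxTensor_eq_mulCompCLM` — the box tensor `a ⊠ g` IS the value at `a` of the continuous linear map ★
  `SchwartzMap.mulCompCLM g (restrictCLM inl) (restrictCLM inr)` (`rfl`): `a ↦ a ⊠ g` is a `ℂ`-CLM.
* §2 **`unitaryOpPi_placeBlock_mulSingle_doubled_schwartzTransport_frameD_general`**: for every `W ∈ U(n)`, every real place `v₀`,
  EVERY `a ∈ 𝓢(ℝ^{Fin n × places})` and every multi-index `β₂` of one copy,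
  `μ₀((W ⊕ 1)^{e₂} at v₀) (frameD^* R_{e₂}((frameV^*)⁻¹ a ⊠ h^V_{β₂})) = frameD^* R_{e₂}((frameV^*)⁻¹(μ₀(W at v₀) a) ⊠ h^V_{β₂})` —
  both sides are `ℂ`-CLMs in `a` (§1 + ★ `schwartzTransport`, ★ `schwartzReindexCLM`, ★ `unitaryOpPi`), they agree on every Hermite function
  `a = h_{β₁}` by ★ β-II `unitaryOpPi_placeBlock_mulSingle_doubled_schwartzTransport_frameD` (`(frameV^*)⁻¹ h_β = follandHermite frameV β`), hence
  everywhere by the density of Hermite functions in `𝓢` (★ `clm_eq_of_eq_on_hermitePi`); and its `carrierConjEquiv` form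
  **`carrierConjEquiv_frameD_placeBlock_mulSingle_doubled_archBoxTensor_general`** on `R_{e₂}(a₁ ⊠ h^V_{β₂})` for every `a₁ ∈ 𝓢((K ⊗ ℝ)^{Fin n})`.
  This is the first-slot generality the ι-step needs: the hyperbolic ladder operator is read on `A_t h_β`, a NON-Hermite Schwartz function.

HONEST SCOPE.  Frame bookkeeping in the Schwartz∕Fock model ([Folland1989, §1.7, §4.2 Prop. (4.39)]); nothing of [Liu2021] or
[GelbartRogawski1991] is asserted.  HC_CM is proved only modulo the 7 printed citations (2 remaining: hLiu418 = stmt-HodgeConjecture-24832, h413 =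
stmt-HodgeConjecture-24833) until rung 0 closes; this file books nothing and discharges nothing booked (a `--supports` helper of line LD1).

## References
* [Folland1989] G. B. Folland, *Harmonic Analysis in Phase Space*, Princeton UP (1989), §1.7 (1.81) (Hermite functions are total in `𝓢`),
  §4.2 Prop. (4.39) (the metaplectic operator of a unitary matrix).
* [HarrisKudlaSweet1996] M. Harris, S. Kudla, W. Sweet, J. AMS 9 (1996), §1 (1.9) (the doubled space `𝕍 ⊕ (−𝕍)`).
-/

set_option autoImplicit false

noncomputable section

open scoped Classical
open scoped Matrix Kronecker TensorProduct SchwartzMap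
open NumberField NumberField.InfinitePlace NumberField.mixedEmbedding IsDedekindDomain
open Literature.RepresentationTheory.HeisenbergGroup
open Literature.NumberTheory.Automorphic
open Literature.NumberTheory.Weil1964
open Literature.RepresentationTheory.HarrisKudlaSweet1996
open Literature.NumberTheory.GaloisRepresentations
open Literature.Analysis.SegalBargmann

namespace Literature.NumberTheory.GelbartRogawski1991.GRConstruction

open UnitaryDualPair UnitaryDualPair.ArchSplitting
open Literature.NumberTheory.GelbartRogawski1991.UnitaryDualPair.LocalSplitting
open Literature.RepresentationTheory Literature.RepresentationTheory.KonnoKonno2007 MvPolynomial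

variable (L : Type) [Field L] [NumberField L] [IsCMField L]

variable {N M n : ℕ} (e : Fin N × Fin M ≃ Fin n)
  (dV : Fin N → L) (hdV : ∀ i, IsCMField.complexConj L (dV i) = dV i) (hdV0 : ∀ i, dV i ≠ 0)
  (dW : Fin M → L) (hdW : ∀ i, IsCMField.complexConj L (dW i) = dW i) (hdW0 : ∀ i, dW i ≠ 0)

/-! ## §1 The box tensor is a continuous linear map in its first slot -/

/-- the norm control of `(K ⊗ ℝ)^{ι₁ ⊕ ι₂}` by its two restrictions (the bound ★ `archBoxTensor` is built with). [folklore] -/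
private theorem norm_le_one_mul_max_restrict {K : Type} [Field K] [NumberField K] {ι₁ ι₂ : Type} [Fintype ι₁] [Fintype ι₂]
    (x : ι₁ ⊕ ι₂ → mixedSpace K) :
    ‖x‖ ≤ 1 * max ‖SchwartzMap.restrictCLM (E := mixedSpace K) Sum.inl x‖ ‖SchwartzMap.restrictCLM (E := mixedSpace K) Sum.inr x‖ := by
  rw [one_mul, pi_norm_le_iff_of_nonneg (by positivity)]
  rintro (i | j)
  · exact (norm_le_pi_norm (x ∘ Sum.inl) i).trans (le_max_left _ _)
  · exact (norm_le_pi_norm (x ∘ Sum.inr) j).trans (le_max_right _ _)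

/-- **`a ↦ a ⊠ g` is the continuous linear map ★ `SchwartzMap.mulCompCLM g (restrict inl) (restrict inr)`** (`rfl`: both are
`x ↦ a (x ∘ inl) · g (x ∘ inr)`). [cite: Folland1989, §1.7] -/
theorem archBoxTensor_eq_mulCompCLM {K : Type} [Field K] [NumberField K] {ι₁ ι₂ : Type} [Fintype ι₁] [Fintype ι₂]
    (a : 𝓢((ι₁ → mixedSpace K), ℂ)) (g : 𝓢((ι₂ → mixedSpace K), ℂ)) :
    archBoxTensor a g =
      SchwartzMap.mulCompCLM g (SchwartzMap.restrictCLM (E := mixedSpace K) Sum.inl) (SchwartzMap.restrictCLM (E := mixedSpace K) Sum.inr)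
        ⟨1, norm_le_one_mul_max_restrict⟩ a := by
  ext x
  rfl

/-! ## §2 β-II on a general first slot -/

/-- **THE DOUBLED METAPLECTIC OPERATOR AT ONE PLACE, GENERAL FIRST SLOT**: for every `W ∈ U(n)`, every real place `v₀`, EVERY
`a ∈ 𝓢(ℝ^{Fin n × places})` and every multi-index `β₂` of one copy,
`μ₀((W ⊕ 1)^{e₂} at v₀) (frameD^* R_{e₂}((frameV^*)⁻¹ a ⊠ h^V_{β₂})) = frameD^* R_{e₂}((frameV^*)⁻¹(μ₀(W at v₀) a) ⊠ h^V_{β₂})`.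
Proof: both sides are continuous `ℂ`-linear in `a` (§1) and agree on every `hermitePi β₁` by ★ β-II
`unitaryOpPi_placeBlock_mulSingle_doubled_schwartzTransport_frameD`; Hermite functions are total (★ `clm_eq_of_eq_on_hermitePi`).
[cite: Folland1989, §1.7 (1.81), §4.2 Prop (4.39)] [cite: HarrisKudlaSweet1996, §1 (1.9)] -/
theorem unitaryOpPi_placeBlock_mulSingle_doubled_schwartzTransport_frameD_general (W : Matrix.unitaryGroup (Fin n) ℂ)
    (v₀ : {v : InfinitePlace (Fp L) // v.IsReal})
    (a : 𝓢(((Fin n × {v : InfinitePlace (Fp L) // v.IsReal}) → ℝ), ℂ))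
    (β₂ : (Fin n × {v : InfinitePlace (Fp L) // v.IsReal}) →₀ ℕ) :
    unitaryOpPi (placeBlock (Pi.mulSingle v₀ (reindexUnitary (e₂ (n := n)).symm (blockU (W, 1)))))
        (schwartzTransport (frameD L e dV hdV hdV0 dW hdW hdW0)
          (schwartzReindexCLM (Fp L) (e₂ (n := n))
            (archBoxTensor ((schwartzTransport (frameV L e dV hdV hdV0 dW hdW hdW0)).symm a)
              (follandHermite (frameV L e dV hdV hdV0 dW hdW hdW0) β₂)))) =
      schwartzTransport (frameD L e dV hdV hdV0 dW hdW hdW0)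
        (schwartzReindexCLM (Fp L) (e₂ (n := n))
          (archBoxTensor
            ((schwartzTransport (frameV L e dV hdV hdV0 dW hdW hdW0)).symm
              (unitaryOpPi (placeBlock (Pi.mulSingle v₀ W)) a))
            (follandHermite (frameV L e dV hdV hdV0 dW hdW hdW0) β₂))) := by
  -- the first-slot box map `a₁ ↦ R_{e₂}(a₁ ⊠ h^V_{β₂})` read in `frameD`, as a CLM of `a₁`
  let B : 𝓢(((Fin n) → mixedSpace (Fp L)), ℂ) →L[ℂ]
      𝓢((((Fin (n + n)) × {v : InfinitePlace (Fp L) // v.IsReal}) → ℝ), ℂ) :=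
    ((schwartzTransport (frameD L e dV hdV hdV0 dW hdW hdW0) :
        𝓢(((Fin (n + n)) → mixedSpace (Fp L)), ℂ) →L[ℂ] 𝓢((((Fin (n + n)) × {v : InfinitePlace (Fp L) // v.IsReal}) → ℝ), ℂ)).comp
      ((schwartzReindexCLM (Fp L) (e₂ (n := n))).comp
        (SchwartzMap.mulCompCLM (follandHermite (frameV L e dV hdV hdV0 dW hdW hdW0) β₂)
          (SchwartzMap.restrictCLM (E := mixedSpace (Fp L)) Sum.inl) (SchwartzMap.restrictCLM (E := mixedSpace (Fp L)) Sum.inr)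
          ⟨1, norm_le_one_mul_max_restrict⟩)))
  have hB : ∀ a₁ : 𝓢(((Fin n) → mixedSpace (Fp L)), ℂ),
      B a₁ = schwartzTransport (frameD L e dV hdV hdV0 dW hdW hdW0)
        (schwartzReindexCLM (Fp L) (e₂ (n := n))
          (archBoxTensor a₁ (follandHermite (frameV L e dV hdV hdV0 dW hdW hdW0) β₂))) := fun a₁ => by
    simp only [B, ContinuousLinearMap.coe_comp, ContinuousLinearEquiv.coe_coe, Function.comp_apply, archBoxTensor_eq_mulCompCLM]
  -- the two sides as CLMs of `a`
  let S : 𝓢(((Fin n × {v : InfinitePlace (Fp L) // v.IsReal}) → ℝ), ℂ) →L[ℂ]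
      𝓢((((Fin (n + n)) × {v : InfinitePlace (Fp L) // v.IsReal}) → ℝ), ℂ) :=
    (unitaryOpPi (placeBlock (Pi.mulSingle v₀ (reindexUnitary (e₂ (n := n)).symm (blockU (W, 1)))))).comp
      (B.comp ((schwartzTransport (frameV L e dV hdV hdV0 dW hdW hdW0)).symm :
        𝓢(((Fin n × {v : InfinitePlace (Fp L) // v.IsReal}) → ℝ), ℂ) →L[ℂ] 𝓢(((Fin n) → mixedSpace (Fp L)), ℂ)))
  let T : 𝓢(((Fin n × {v : InfinitePlace (Fp L) // v.IsReal}) → ℝ), ℂ) →L[ℂ]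
      𝓢((((Fin (n + n)) × {v : InfinitePlace (Fp L) // v.IsReal}) → ℝ), ℂ) :=
    B.comp (((schwartzTransport (frameV L e dV hdV hdV0 dW hdW hdW0)).symm :
        𝓢(((Fin n × {v : InfinitePlace (Fp L) // v.IsReal}) → ℝ), ℂ) →L[ℂ] 𝓢(((Fin n) → mixedSpace (Fp L)), ℂ)).comp
      (unitaryOpPi (placeBlock (Pi.mulSingle v₀ W))))
  have hS : ∀ a', S a' = unitaryOpPi (placeBlock (Pi.mulSingle v₀ (reindexUnitary (e₂ (n := n)).symm (blockU (W, 1)))))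
        (schwartzTransport (frameD L e dV hdV hdV0 dW hdW hdW0)
          (schwartzReindexCLM (Fp L) (e₂ (n := n))
            (archBoxTensor ((schwartzTransport (frameV L e dV hdV hdV0 dW hdW hdW0)).symm a')
              (follandHermite (frameV L e dV hdV hdV0 dW hdW hdW0) β₂)))) := fun a' => by
    simp only [S, ContinuousLinearMap.coe_comp, ContinuousLinearEquiv.coe_coe, Function.comp_apply, hB]
  have hT : ∀ a', T a' = schwartzTransport (frameD L e dV hdV hdV0 dW hdW hdW0)
        (schwartzReindexCLM (Fp L) (e₂ (n := n))
          (archBoxTensor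
            ((schwartzTransport (frameV L e dV hdV hdV0 dW hdW hdW0)).symm
              (unitaryOpPi (placeBlock (Pi.mulSingle v₀ W)) a'))
            (follandHermite (frameV L e dV hdV hdV0 dW hdW hdW0) β₂))) := fun a' => by
    simp only [T, ContinuousLinearMap.coe_comp, ContinuousLinearEquiv.coe_coe, Function.comp_apply, hB]
  -- they agree on every Hermite function (★ β-II), hence everywhere
  have hST : S = T := by
    refine clm_eq_of_eq_on_hermitePi fun β₁ => ?_
    rw [hS, hT]
    have h1 : (schwartzTransport (frameV L e dV hdV hdV0 dW hdW hdW0)).symm (hermitePi β₁) =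
        follandHermite (frameV L e dV hdV hdV0 dW hdW hdW0) β₁ := rfl
    rw [h1]
    exact unitaryOpPi_placeBlock_mulSingle_doubled_schwartzTransport_frameD L e dV hdV hdV0 dW hdW hdW0 W v₀ β₁ β₂
  rw [← hS, ← hT, hST]

/-- **`carrierConjEquiv` form** (the shape ★ T2 `pairRep_chiSplittingLine_adelicSingle_tmul_of_box` ∕ ★ `F0LD1ThetaArchCompactStep` §1 consume), GENERAL
FIRST SLOT: on `R_{e₂}(a₁ ⊠ h^V_{β₂})` for every `a₁ ∈ 𝓢((K ⊗ ℝ)^{Fin n})`,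
`carrierConjEquiv frameD (μ₀((W ⊕ 1)^{e₂} at v₀))` is `R_{e₂}(carrierConjEquiv frameV (μ₀(W at v₀)) a₁ ⊠ h^V_{β₂})`.
[cite: Folland1989, §4.2 (4.23), Prop (4.39)] [cite: HarrisKudlaSweet1996, §1 (1.9)] -/
theorem carrierConjEquiv_frameD_placeBlock_mulSingle_doubled_archBoxTensor_general (W : Matrix.unitaryGroup (Fin n) ℂ)
    (v₀ : {v : InfinitePlace (Fp L) // v.IsReal}) (a₁ : 𝓢(((Fin n) → mixedSpace (Fp L)), ℂ))
    (β₂ : (Fin n × {v : InfinitePlace (Fp L) // v.IsReal}) →₀ ℕ) :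
    carrierConjEquiv (frameD L e dV hdV hdV0 dW hdW hdW0)
        (unitaryEquivPi (placeBlock (Pi.mulSingle v₀ (reindexUnitary (e₂ (n := n)).symm (blockU (W, 1))))))
        (schwartzReindexCLM (Fp L) (e₂ (n := n))
          (archBoxTensor a₁ (follandHermite (frameV L e dV hdV hdV0 dW hdW hdW0) β₂))) =
      schwartzReindexCLM (Fp L) (e₂ (n := n))
        (archBoxTensor
          (carrierConjEquiv (frameV L e dV hdV hdV0 dW hdW hdW0) (unitaryEquivPi (placeBlock (Pi.mulSingle v₀ W))) a₁)
          (follandHermite (frameV L e dV hdV hdV0 dW hdW hdW0) β₂)) := by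
  have h := unitaryOpPi_placeBlock_mulSingle_doubled_schwartzTransport_frameD_general L e dV hdV hdV0 dW hdW hdW0 W v₀
    (schwartzTransport (frameV L e dV hdV hdV0 dW hdW hdW0) a₁) β₂
  rw [ContinuousLinearEquiv.symm_apply_apply] at h
  rw [carrierConjEquiv_apply, carrierConjEquiv_apply, unitaryEquivPi_apply, unitaryEquivPi_apply, h,
    ContinuousLinearEquiv.symm_apply_apply]

end Literature.NumberTheory.GelbartRogawski1991.GRConstruction

end
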